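import Literature.NumberTheory.GaloisRepresentations.PhiGammaModuleRobba
import HarnessLib

/-!
# `PhiGammaModuleRobba`: the degenerate datum; `HasCFTIdentification` is a hypothesis, not a theorem

Companion file of `Literature.NumberTheory.GaloisRepresentations.PhiGammaModuleRobba` (nothing
there is restated; the sibling `PhiGammaModuleRobbaProofs.lean` treats the graded classes of a
triangulation and is independent of this file).

`PhiGammaModuleRobba.HasCFTIdentification` (`PhiGammaModuleRobba.lean`, Part 4) — "the map
`homToH1 : Hom(Fˣ, E) → H¹_{φ,γ_F}(𝓡_E(π_F))` of the datum is bijective" — is a `Prop`-valued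
PREDICATE on an abstract datum `𝓣 : PhiGammaModuleRobba p F E` (its binder comes from a
`variable`, so the elaborated type is `PhiGammaModuleRobba p F E → Prop`), one of the conjuncts of
the hypothesis `IsKPX d` that routes posit, listed in that file under "Predicates (nothing
asserted)".  In the datum, `homToH1` is a FIELD (arbitrary data), as are the ring playing
`𝓡_E(π_F)`, its `φ`, the `Γ_F^abs`-action and `gen`.  This file records, sorry-free, that the
predicate is a genuine hypothesis and not a consequence of the axioms of the datum, and ships the
non-vacuity witness announced in the design notes of `PhiGammaModuleRobba.lean`:

* `PhiGammaModuleData.exists_degenerate`: for `F` separably closed (so `Γ_F^abs = Aut_F(F̄) = 1`: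
  `F̄/F` is purely inseparable, Mathlib) and every prime `p`, the axioms of
  `PhiGammaModuleData p F 𝔽₂` (`Trianguline.lean`) hold for the ring `𝔽₂ = ZMod 2` with `φ = id`
  and the trivial action, all `D_rig(ρ)` and all `𝓡(δ)` being the trivial framed modules (every
  `ρ : Γ_F^abs →ₜ* GL_n(𝔽₂)` and every `δ : Fˣ →ₜ* 𝔽₂ˣ` is trivial).
* `PhiGammaModuleRobba.exists_not_hasCFTIdentification`: enriched by the discrete topology,
  `gen = 1` and `homToH1 = 0`, this is a `PhiGammaModuleRobba p F 𝔽₂` for which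
  `HasCFTIdentification` FAILS: the cocycle `(1, 0) ∈ Z¹` of the Herr complex of the unit object
  (on the `torsionKernel`-invariants, `γ₀ = gen`) is a coboundary only if `φ z - z = 1` for some
  invariant `z`, impossible for `φ = id`; so `H¹ ≠ 0` and `homToH1 = 0` is not surjective.
* `PhiGammaModuleRobba.not_forall_hasCFTIdentification`: hence `∀ 𝓣, 𝓣.HasCFTIdentification` is
  false (witness `p = 2`, `F = ℂ`, `E = 𝔽₂`).
* `PhiGammaModuleRobba.nonempty_of_isSepClosed`: in particular the enriched datum is inhabited
  (joint satisfiability of its field axioms).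

## The genuine statement, for the record

For the GENUINE objects — `F/ℚ_p` and `E/ℚ_p` finite, the Robba ring `𝓡_E(π_F)` with its `φ` and
`Γ_F`-action — the identification is the composite
`Hom_cont(Fˣ, E) ≅ Hom_cont(G_F, E) = H¹(G_F, E) ≅ H¹_{φ,γ_F}(𝓡_E(π_F))` of local class field theory
with the comparison of continuous Galois cohomology and `(φ, Γ)`-cohomology,
`RΓ_cont(G_K, V) ≅ RΓ_{φ,γ_K}(D_rig(V))` [cite: KedlayaPottharstXiao2014, Prop. 2.3.7] at `V = E`,
as used in [cite: Ding2019SimpleL, §3.1]; both sides have dimension `[F:ℚ_p] + 1`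
[cite: KedlayaPottharstXiao2014, Prop. 6.2.8 (3)].  It is a property of that instance, which the
tree does not construct (the existence placeholder is the named fact `PhiGammaModuleData.nonempty`
of `Trianguline.lean`); once the instance is built it is to be proved there, as
`theorem … : (instance).HasCFTIdentification`, and nothing in this file obstructs that.

## What is deliberately NOT here

No statement about the genuine Robba ring.  No discussion of the sibling predicates
`HasLiuFiniteness d`, `HasRankOneCohomology d`, `HasRankOneClassification`, `HasDrigEtale`, `IsKPX d`
(the same remark applies: hypotheses on the datum, of type `PhiGammaModuleRobba p F E → …`).

## Mathlib / Literature declarations used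

`PhiGammaModuleData`, `FramedPhiGammaModule.trivial`, `FramedPhiGammaModule.IsIso.refl`,
`FramedGaloisRep` (`Trianguline.lean`, `GaloisRep.lean`); `PhiGammaModuleRobba`,
`PhiGammaModule.unit`, `PhiGammaModule.invariants` / `mem_invariants_iff`, `phiInv`, `actInv`,
`Herr.Z1` / `mem_Z1_iff`, `Herr.B1` / `mem_B1_iff`, `Herr.H1.mk` / `mk_eq_zero_iff`,
`torsionKernel`, `conj_mem_torsionKernel`, `HomCont` (`PhiGammaModuleRobba.lean`); Mathlib
`AlgEquiv.coe_toAlgHom_injective` with the `Subsingleton (F̄ →ₐ[F] F̄)` instance for purely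
inseparable `F̄/F`, the discrete topology on `ZMod 2`, `continuous_of_discreteTopology`,
`dense_univ`, `ContinuousMonoidHom.ext`.

## References

* K. S. Kedlaya, J. Pottharst, L. Xiao, *Cohomology of arithmetic families of `(φ, Γ)`-modules*,
  JAMS 27 (2014), arXiv:1203.5718 — Prop. 2.3.7, Prop. 6.2.8. [KedlayaPottharstXiao2014]
* Y. Ding, *Simple `𝓛`-invariants for `GL_n`*, Trans. AMS 372 (2019), arXiv:1807.10862 — §3.1.
  [Ding2019SimpleL]
-/

namespace Literature.NumberTheory.GaloisRepresentations

universe u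

open PhiGammaModule

section Degenerate

variable (p : ℕ) [Fact p.Prime] (F : Type u) [Field F] [TopologicalSpace F] [IsSepClosed F]

/-- Over a separably closed field `F` (so `Γ_F^abs = 1`) the axioms of `PhiGammaModuleData p F 𝔽₂`
are satisfied by the DEGENERATE datum: ring `𝔽₂` with `φ = id` and the trivial action, every
`D_rig(ρ)` and every `𝓡(δ)` the trivial framed module (all `ρ` are trivial as `Γ_F^abs = 1`, all
`δ : Fˣ → 𝔽₂ˣ = 1` are trivial).  A non-vacuity witness only; recorded with the identities
(`φ = id`, trivial action, `D_rig = 𝓡(δ) = trivial`) that make it usable. [folklore] -/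
theorem PhiGammaModuleData.exists_degenerate :
    ∃ 𝔇 : PhiGammaModuleData.{u, 0, 0} p F (ZMod 2),
      (∀ r : 𝔇.ring.R, 𝔇.ring.frob r = r) ∧
        (∀ (σ : Field.absoluteGaloisGroup F) (r : 𝔇.ring.R), σ • r = r) ∧
          (∀ (n : ℕ) (ρ : FramedGaloisRep F (ZMod 2) n),
              𝔇.Drig ρ = FramedPhiGammaModule.trivial 𝔇.ring n) ∧
            ∀ δ : Fˣ →ₜ* (ZMod 2)ˣ, 𝔇.charMod δ = FramedPhiGammaModule.trivial 𝔇.ring 1 := by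
  haveI : Subsingleton (Field.absoluteGaloisGroup F) :=
    (AlgEquiv.coe_toAlgHom_injective (R := F) (A₁ := AlgebraicClosure F)
      (A₂ := AlgebraicClosure F)).subsingleton
  letI : MulSemiringAction (Field.absoluteGaloisGroup F) (ZMod 2) :=
    { smul := fun _ r => r
      one_smul := fun _ => rfl
      mul_smul := fun _ _ _ => rfl
      smul_zero := fun _ => rfl
      smul_add := fun _ _ _ => rfl
      smul_one := fun _ => rfl
      smul_mul := fun _ _ _ => rfl }
  haveI : SMulCommClass (Field.absoluteGaloisGroup F) (ZMod 2) (ZMod 2) := ⟨fun _ _ _ => rfl⟩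
  let 𝓡 : PhiGammaRing.{u, 0, 0} (Field.absoluteGaloisGroup F) (ZMod 2) :=
    { R := ZMod 2, frob := AlgHom.id _ _, frob_smul := fun _ _ => rfl }
  have hrep : ∀ (n : ℕ) (ρ ρ' : FramedGaloisRep F (ZMod 2) n), ρ = ρ' := fun n ρ ρ' =>
    ContinuousMonoidHom.ext fun σ => by rw [Subsingleton.elim σ 1, map_one, map_one]
  have h1 : ∀ u : (ZMod 2)ˣ, u = 1 := by decide
  have hchar : ∀ δ δ' : Fˣ →ₜ* (ZMod 2)ˣ, δ = δ' := fun δ δ' =>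
    ContinuousMonoidHom.ext fun a => by rw [h1 (δ a), h1 (δ' a)]
  exact
    ⟨{ ring := 𝓡
       smul_eq_self := fun _ _ _ => rfl
       Drig := fun {n} _ => FramedPhiGammaModule.trivial 𝓡 n
       Drig_matGamma_eq_one := fun _ _ _ => rfl
       Drig_conj := fun _ _ => FramedPhiGammaModule.IsIso.refl _
       Drig_injective := fun ρ ρ' _ => ⟨1, hrep _ _ _⟩
       Drig_one := fun _ => FramedPhiGammaModule.IsIso.refl _
       charMod := fun _ => FramedPhiGammaModule.trivial 𝓡 1
       charMod_matGamma_eq_one := fun _ _ _ => rfl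
       charMod_one := FramedPhiGammaModule.IsIso.refl _
       charMod_injective := fun δ δ' _ => hchar δ δ'
       Drig_rank_one := fun _ => ⟨1, FramedPhiGammaModule.IsIso.refl _⟩ },
      fun _ => rfl, fun _ _ => rfl, fun _ _ => rfl, fun _ => rfl⟩

/-- **`HasCFTIdentification` is not a theorem about the abstract datum**: over a separably
closed `F`, the degenerate datum of `PhiGammaModuleData.exists_degenerate`, enriched by the
discrete topology, `gen = 1` and `homToH1 = 0`, is a `PhiGammaModuleRobba p F 𝔽₂` whose
`homToH1` is not bijective — the class of the cocycle `(1, 0)` in `H¹_{φ,γ}` is non-zero (it is a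
coboundary only if `φ z - z = 1` for some invariant `z`, impossible when `φ = id`). [folklore] -/
theorem PhiGammaModuleRobba.exists_not_hasCFTIdentification :
    ∃ 𝓣 : PhiGammaModuleRobba.{u, 0, 0} p F (ZMod 2), ¬ 𝓣.HasCFTIdentification := by
  obtain ⟨𝔇, hfrob, hact, -, -⟩ := PhiGammaModuleData.exists_degenerate p F
  haveI : Subsingleton (Field.absoluteGaloisGroup F) :=
    (AlgEquiv.coe_toAlgHom_injective (R := F) (A₁ := AlgebraicClosure F)
      (A₂ := AlgebraicClosure F)).subsingleton
  letI : TopologicalSpace 𝔇.ring.R := ⊥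
  haveI : DiscreteTopology 𝔇.ring.R := ⟨rfl⟩
  have hdense : Dense ((Subgroup.closure {(1 : Field.absoluteGaloisGroup F)} ⊔ torsionKernel p F :
      Subgroup (Field.absoluteGaloisGroup F)) : Set (Field.absoluteGaloisGroup F)) := by
    have h : ((Subgroup.closure {(1 : Field.absoluteGaloisGroup F)} ⊔ torsionKernel p F :
        Subgroup (Field.absoluteGaloisGroup F)) : Set (Field.absoluteGaloisGroup F)) = Set.univ :=
      Set.eq_univ_of_forall fun σ => by
        rw [Subsingleton.elim σ 1]
        exact Subgroup.one_mem _
    rw [h]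
    exact dense_univ
  refine ⟨{ toPhiGammaModuleData := 𝔇
            continuous_frob := continuous_of_discreteTopology
            continuous_act := fun _ => continuous_of_discreteTopology
            continuous_orbit := fun r => continuous_const.congr fun σ => (hact σ r).symm
            gen := 1
            dense_gen := hdense
            homToH1 := 0
            IsEtale := fun _ => True }, fun h => ?_⟩
  -- The Herr complex of the unit object `R` on the `torsionKernel`-invariants, `γ₀ = gen = 1`.
  have hγ := conj_mem_torsionKernel p F (1 : Field.absoluteGaloisGroup F)
  have h1mem : (1 : 𝔇.ring.R) ∈ (PhiGammaModule.unit 𝔇.ring).invariants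
      (torsionKernel p F : Set (Field.absoluteGaloisGroup F)) :=
    ((PhiGammaModule.unit 𝔇.ring).mem_invariants_iff _ _).2 fun δ _ => hact δ 1
  -- the cocycle `(1, 0)`: `γ₀(1) - 1 = 0 = φ(0) - 0`
  have hZ : ((⟨1, h1mem⟩, 0) : (PhiGammaModule.unit 𝔇.ring).invariants _ ×
      (PhiGammaModule.unit 𝔇.ring).invariants _) ∈
        Herr.Z1 ((PhiGammaModule.unit 𝔇.ring).phiInv _) ((PhiGammaModule.unit 𝔇.ring).actInv 1
          (torsionKernel p F : Set (Field.absoluteGaloisGroup F)) hγ) := by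
    rw [Herr.mem_Z1_iff, map_zero, sub_zero, sub_eq_zero]
    exact Subtype.ext ((PhiGammaModule.unit 𝔇.ring).act_one_apply _)
  -- `homToH1 = 0` is surjective by hypothesis, so the class of `(1, 0)` vanishes …
  have hsurj : Function.Surjective
      (0 : HomCont F (ZMod 2) →ₗ[ZMod 2] Herr.H1 ((PhiGammaModule.unit 𝔇.ring).phiInv _)
        ((PhiGammaModule.unit 𝔇.ring).actInv 1
          (torsionKernel p F : Set (Field.absoluteGaloisGroup F)) hγ)) := h.2
  obtain ⟨ψ, hψ⟩ := hsurj (Herr.H1.mk _ _ ⟨_, hZ⟩)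
  rw [LinearMap.zero_apply, eq_comm, Herr.H1.mk_eq_zero_iff, Herr.mem_B1_iff] at hψ
  -- … i.e. `(1, 0) = (φ z - z, γ₀ z - z)` for some invariant `z`; but `φ z - z = 0 ≠ 1`.
  obtain ⟨z, hz⟩ := hψ
  have hz1 : (𝔇.ring.frob (z : 𝔇.ring.R) - z : 𝔇.ring.R) = 1 :=
    congrArg (fun w => ((w.1 : (PhiGammaModule.unit 𝔇.ring).invariants _) : 𝔇.ring.R)) hz
  rw [hfrob, sub_self] at hz1
  exact zero_ne_one hz1

end Degenerate

/-- Hence the universal closure of the predicate `HasCFTIdentification` is FALSE: it is a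
hypothesis on the datum (a conjunct of `IsKPX`), to be proved for the genuine Robba-ring instance,
not a fact to discharge. Witness: `p = 2`, `F = ℂ`, `E = 𝔽₂`. [folklore] -/
theorem PhiGammaModuleRobba.not_forall_hasCFTIdentification :
    ¬ ∀ (p : ℕ) [Fact p.Prime] (F : Type) [Field F] [TopologicalSpace F] (E : Type) [Field E]
        [TopologicalSpace E] [IsTopologicalRing E] (𝓣 : PhiGammaModuleRobba.{0, 0, 0} p F E),
        𝓣.HasCFTIdentification := fun h => by
  obtain ⟨𝓣, h𝓣⟩ := PhiGammaModuleRobba.exists_not_hasCFTIdentification 2 ℂ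
  exact h𝓣 (h 2 ℂ (ZMod 2) 𝓣)

/-- Non-vacuity of the enriched datum: `PhiGammaModuleRobba p F 𝔽₂` is inhabited for every prime
`p` and every separably closed `F` (by a degenerate datum). [folklore] -/
theorem PhiGammaModuleRobba.nonempty_of_isSepClosed (p : ℕ) [Fact p.Prime] (F : Type u) [Field F]
    [TopologicalSpace F] [IsSepClosed F] : Nonempty (PhiGammaModuleRobba.{u, 0, 0} p F (ZMod 2)) :=
  let ⟨𝓣, _⟩ := PhiGammaModuleRobba.exists_not_hasCFTIdentification p F
  ⟨𝓣⟩

end Literature.NumberTheory.GaloisRepresentations
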